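import Mathlib.Combinatorics.SimpleGraph.Acyclic
import Summits.CriticalPhenomena.PercolationContinuityZ3.Theorems.PercNearOneGluingNoHeavyLowerTailAPLProfilePendant
import Summits.CriticalPhenomena.PercolationContinuityZ3.Theorems.PercNearOneGluingNoHeavyLowerTailAPLConjFForestMeasure
import HarnessLib

/-!
# `NoHeavyLowerTail` (stmt-CriticalPhenomena-4575) — THEOREM B_P: the PROFILE row APL-P `P(a|b|c)³ ≤ P(a∤bc)·(P(b∤ac)·P(c∤ab))^{3/2}` on every weighted graph whose edges avoiding `b, c` form a forest

Support file (prover prim-ineq-gen-8 gen 37; `--supports stmt-CriticalPhenomena-4575`; memos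
run/shared/lean/prim/prim-ineq-gen-8/FINDING-gen31-APL-PROFILE.md §5 (THEOREM B_P on paper) and FINDING-gen37-PROFILE-FOREST.md).
No definitions, no named facts, no sorries.

SETTING (as in `…APLConjFForest.lean`).  A finite vertex type `V`, weights `0 ≤ p ≤ 1`, a loop-free edge set `D`, distinct terminals
`a, b, c`; the five `PrW D p` cells `u0 = P(a|b|c)`, `uab = P(ab|c)`, `uac = P(ac|b)`, `ubc = P(a|bc)`, `u3 = P(abc)` of `(a; b, c)`;
isolation probabilities `isoA = u0 + ubc = P(a ∤ bc)`, `isoB = u0 + uac = P(b ∤ ac)`, `isoC = u0 + uab = P(c ∤ ab)`.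
THE REGION `P` (gen 31's PROFILE row APL-P, squared polynomial form): **`u0⁶ ≤ isoA² · (isoC · isoB)³`**, i.e.
`P(a|b|c)³ ≤ P(a∤bc)·(P(b∤ac)P(c∤ab))^{3/2}` — in the symmetric case exactly the Poisson hub-tree envelope `ρ_G ≤ 1 − s²(2−s)` of prove-5 g35,
tight along the whole extremal hierarchy; it implies APL(2/3) (`APL.apl23_of_profile_cells`).  Since Harris gives `P(b∤ac)·P(c∤ab) ≤ P(a|b|c)`
(both events decreasing, their intersection is `a|b|c`), APL-P is a REVERSE-Harris bound `P(a|b|c) ≤ P(a∤bc)^{1/3}·(P(b∤ac)P(c∤ab))^{1/2}`.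
* `profile_union_cells` — `P` is closed under the apex piece-union (`u0`, `isoA`, `isoB`, `isoC` are multiplicative; product of two inequalities);
* `split_isoA/B/C` — the isolation probabilities as sums of two cells;
* `pregion_glue`, `pregion_pendant` (uses `profile_pendant`, the convexity lemma of `…APLProfilePendant.lean`), `pregion_afree`, `pregion_bEdge`,
  `pregion_cEdge` — the steps and base pieces of the forest induction for `P` (same skeleton as `conjF_forest`);
* **`profile_forest`** — THEOREM B_P for `PrW` cells: under the forest hypothesis (bridge form) the cells of `(a; b, c)` on `D` lie in `P`;
* **`profile_forest_prodBernoulli`**, **`profile_forest_iso`**, **`profile_forest_rpow`** — the same for `μ = prodBernoulli w` whenever the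
  positive-weight non-loop pairs avoiding `b, c` form an acyclic graph (`SimpleGraph.IsAcyclic`):
  `μ(a|b|c)⁶ ≤ μ(a∤bc)²·(μ(b∤ac)·μ(c∤ab))³` and `μ(a|b|c)³ ≤ μ(a∤bc)·(μ(b∤ac)·μ(c∤ab))^(3/2)`.
[this work]
-/

namespace Summit.CriticalPhenomena.PercolationContinuityZ3.Theorems

namespace APL

open MeasureTheory Literature.Probability.Percolation Literature.Probability.Percolation.Gladkov
  Literature.Probability.Percolation.DecisionTree Literature.Probability.LatticeModels
open scoped Classical

/-- **`P` is closed under the apex piece-union** (cells need not be normalised): `u0`, `u0+ubc`, `u0+uab`, `u0+uac` are multiplicative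
under the union, so the two profile inequalities multiply. [this work] -/
theorem profile_union_cells (u0 uab uac ubc v0 vab vac vbc : ℝ)
    (hu0 : 0 ≤ u0) (huab : 0 ≤ uab) (huac : 0 ≤ uac) (hv0 : 0 ≤ v0)
    (hu : u0^6 ≤ (u0+ubc)^2 * ((u0+uab)*(u0+uac))^3) (hv : v0^6 ≤ (v0+vbc)^2 * ((v0+vab)*(v0+vac))^3) :
    (u0 * v0)^6 ≤ (u0 * v0 + (u0 * vbc + ubc * v0 + ubc * vbc))^2
      * ((u0 * v0 + (u0 * vab + uab * v0 + uab * vab)) * (u0 * v0 + (u0 * vac + uac * v0 + uac * vac)))^3 := by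
  have h := mul_le_mul hu hv (pow_nonneg hv0 6) (by positivity)
  exact (h.trans_eq (by ring)).trans_eq' (by ring)

variable {V : Type*} [Fintype V]

section Cells

variable [DecidableEq V]

/-- `P(a ∤ bc) = u0 + ubc`. [folklore] -/
theorem split_isoA (p : Sym2 V → ℝ) (D : Finset (Sym2 V)) (a b c : V) :
    PrW D p {K : Finset (Sym2 V) | b ∉ cl K a ∧ c ∉ cl K a} = PrW D p {K : Finset (Sym2 V) | b ∉ cl K a ∧ c ∉ cl K a ∧ c ∉ cl K b} + PrW D p {K : Finset (Sym2 V) | b ∉ cl K a ∧ c ∉ cl K a ∧ c ∈ cl K b} := by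
  simp only [PrW_eq_sum_ind, ← Finset.sum_add_distrib]
  refine Finset.sum_congr rfl fun S _ => ?_
  rw [← mul_add]
  congr 1
  rcases cl_cell_cases S a b c with ⟨h1, h2, h3⟩ | ⟨h1, h2, h3⟩ | ⟨h1, h2, h3⟩ | ⟨h1, h2, h3⟩ | ⟨h1, h2, h3⟩ <;>
  simp [ind, Set.mem_setOf_eq, h1, h2, h3]

/-- `P(b ∤ ac) = u0 + uac`. [folklore] -/
theorem split_isoB (p : Sym2 V → ℝ) (D : Finset (Sym2 V)) (a b c : V) :
    PrW D p {K : Finset (Sym2 V) | b ∉ cl K a ∧ c ∉ cl K b} = PrW D p {K : Finset (Sym2 V) | b ∉ cl K a ∧ c ∉ cl K a ∧ c ∉ cl K b} + PrW D p {K : Finset (Sym2 V) | c ∈ cl K a ∧ b ∉ cl K a} := by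
  simp only [PrW_eq_sum_ind, ← Finset.sum_add_distrib]
  refine Finset.sum_congr rfl fun S _ => ?_
  rw [← mul_add]
  congr 1
  rcases cl_cell_cases S a b c with ⟨h1, h2, h3⟩ | ⟨h1, h2, h3⟩ | ⟨h1, h2, h3⟩ | ⟨h1, h2, h3⟩ | ⟨h1, h2, h3⟩ <;>
  simp [ind, Set.mem_setOf_eq, h1, h2, h3]

/-- `P(c ∤ ab) = u0 + uab`. [folklore] -/
theorem split_isoC (p : Sym2 V → ℝ) (D : Finset (Sym2 V)) (a b c : V) :
    PrW D p {K : Finset (Sym2 V) | c ∉ cl K a ∧ c ∉ cl K b} = PrW D p {K : Finset (Sym2 V) | b ∉ cl K a ∧ c ∉ cl K a ∧ c ∉ cl K b} + PrW D p {K : Finset (Sym2 V) | b ∈ cl K a ∧ c ∉ cl K a} := by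
  simp only [PrW_eq_sum_ind, ← Finset.sum_add_distrib]
  refine Finset.sum_congr rfl fun S _ => ?_
  rw [← mul_add]
  congr 1
  rcases cl_cell_cases S a b c with ⟨h1, h2, h3⟩ | ⟨h1, h2, h3⟩ | ⟨h1, h2, h3⟩ | ⟨h1, h2, h3⟩ | ⟨h1, h2, h3⟩ <;>
  simp [ind, Set.mem_setOf_eq, h1, h2, h3]

set_option maxHeartbeats 0 in
/-- **Gluing step**: `P` passes to the union of two disjoint edge sets glued at the terminals (`0 ≤ p ≤ 1`). [this work] -/
theorem pregion_glue {p : Sym2 V → ℝ} (hp0 : ∀ e, 0 ≤ p e) (hp1 : ∀ e, p e ≤ 1) (D₁ D₂ : Finset (Sym2 V)) (hdisj : Disjoint D₁ D₂)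
    (a b c : V) (hsep : ∀ v : V, (∃ e ∈ D₁, v ∈ e) → (∃ e ∈ D₂, v ∈ e) → (v = a ∨ v = b ∨ v = c))
    (h₁ : (PrW D₁ p {K : Finset (Sym2 V) | b ∉ cl K a ∧ c ∉ cl K a ∧ c ∉ cl K b}^6 ≤ (PrW D₁ p {K : Finset (Sym2 V) | b ∉ cl K a ∧ c ∉ cl K a ∧ c ∉ cl K b}+PrW D₁ p {K : Finset (Sym2 V) | b ∉ cl K a ∧ c ∉ cl K a ∧ c ∈ cl K b})^2 * ((PrW D₁ p {K : Finset (Sym2 V) | b ∉ cl K a ∧ c ∉ cl K a ∧ c ∉ cl K b}+PrW D₁ p {K : Finset (Sym2 V) | b ∈ cl K a ∧ c ∉ cl K a})*(PrW D₁ p {K : Finset (Sym2 V) | b ∉ cl K a ∧ c ∉ cl K a ∧ c ∉ cl K b}+PrW D₁ p {K : Finset (Sym2 V) | c ∈ cl K a ∧ b ∉ cl K a}))^3))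
    (h₂ : (PrW D₂ p {K : Finset (Sym2 V) | b ∉ cl K a ∧ c ∉ cl K a ∧ c ∉ cl K b}^6 ≤ (PrW D₂ p {K : Finset (Sym2 V) | b ∉ cl K a ∧ c ∉ cl K a ∧ c ∉ cl K b}+PrW D₂ p {K : Finset (Sym2 V) | b ∉ cl K a ∧ c ∉ cl K a ∧ c ∈ cl K b})^2 * ((PrW D₂ p {K : Finset (Sym2 V) | b ∉ cl K a ∧ c ∉ cl K a ∧ c ∉ cl K b}+PrW D₂ p {K : Finset (Sym2 V) | b ∈ cl K a ∧ c ∉ cl K a})*(PrW D₂ p {K : Finset (Sym2 V) | b ∉ cl K a ∧ c ∉ cl K a ∧ c ∉ cl K b}+PrW D₂ p {K : Finset (Sym2 V) | c ∈ cl K a ∧ b ∉ cl K a}))^3)) :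
    (PrW (D₁ ∪ D₂) p {K : Finset (Sym2 V) | b ∉ cl K a ∧ c ∉ cl K a ∧ c ∉ cl K b}^6 ≤ (PrW (D₁ ∪ D₂) p {K : Finset (Sym2 V) | b ∉ cl K a ∧ c ∉ cl K a ∧ c ∉ cl K b}+PrW (D₁ ∪ D₂) p {K : Finset (Sym2 V) | b ∉ cl K a ∧ c ∉ cl K a ∧ c ∈ cl K b})^2 * ((PrW (D₁ ∪ D₂) p {K : Finset (Sym2 V) | b ∉ cl K a ∧ c ∉ cl K a ∧ c ∉ cl K b}+PrW (D₁ ∪ D₂) p {K : Finset (Sym2 V) | b ∈ cl K a ∧ c ∉ cl K a})*(PrW (D₁ ∪ D₂) p {K : Finset (Sym2 V) | b ∉ cl K a ∧ c ∉ cl K a ∧ c ∉ cl K b}+PrW (D₁ ∪ D₂) p {K : Finset (Sym2 V) | c ∈ cl K a ∧ b ∉ cl K a}))^3) := by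
  obtain ⟨n0, n1, n2, _, _⟩ := cells_nonneg hp0 hp1 D₁ a b c
  obtain ⟨m0, _, _, _, _⟩ := cells_nonneg hp0 hp1 D₂ a b c
  have key := profile_union_cells (PrW D₁ p {K : Finset (Sym2 V) | b ∉ cl K a ∧ c ∉ cl K a ∧ c ∉ cl K b}) (PrW D₁ p {K : Finset (Sym2 V) | b ∈ cl K a ∧ c ∉ cl K a}) (PrW D₁ p {K : Finset (Sym2 V) | c ∈ cl K a ∧ b ∉ cl K a}) (PrW D₁ p {K : Finset (Sym2 V) | b ∉ cl K a ∧ c ∉ cl K a ∧ c ∈ cl K b})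
    (PrW D₂ p {K : Finset (Sym2 V) | b ∉ cl K a ∧ c ∉ cl K a ∧ c ∉ cl K b}) (PrW D₂ p {K : Finset (Sym2 V) | b ∈ cl K a ∧ c ∉ cl K a}) (PrW D₂ p {K : Finset (Sym2 V) | c ∈ cl K a ∧ b ∉ cl K a}) (PrW D₂ p {K : Finset (Sym2 V) | b ∉ cl K a ∧ c ∉ cl K a ∧ c ∈ cl K b})
    n0 n1 n2 m0 h₁ h₂
  rw [glued_cell_zero p D₁ D₂ hdisj a b c hsep, glued_cell_ab p D₁ D₂ hdisj a b c hsep, glued_cell_ac p D₁ D₂ hdisj a b c hsep,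
    glued_cell_bc p D₁ D₂ hdisj a b c hsep]
  exact (key.trans_eq (by ring)).trans_eq' (by ring)

set_option maxHeartbeats 0 in
/-- **Pendant step**: if `a` meets exactly the edge `s(a,g)` of `D` (`a ≠ g`, `b, c ≠ a`), `P` passes from `(g; b, c)` on `D.erase s(a,g)`
to `(a; b, c)` on `D` — the convexity lemma `profile_pendant` with `z = p s(a,g)`. [this work] -/
theorem pregion_pendant {p : Sym2 V → ℝ} (hp0 : ∀ e, 0 ≤ p e) (hp1 : ∀ e, p e ≤ 1) (D : Finset (Sym2 V)) (a g b c : V) (hag : a ≠ g)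
    (hba : b ≠ a) (hca : c ≠ a) (he : s(a, g) ∈ D) (hD : ∀ f ∈ D, a ∈ f → f = s(a, g))
    (h : (PrW (D.erase s(a, g)) p {K : Finset (Sym2 V) | b ∉ cl K g ∧ c ∉ cl K g ∧ c ∉ cl K b}^6 ≤ (PrW (D.erase s(a, g)) p {K : Finset (Sym2 V) | b ∉ cl K g ∧ c ∉ cl K g ∧ c ∉ cl K b}+PrW (D.erase s(a, g)) p {K : Finset (Sym2 V) | b ∉ cl K g ∧ c ∉ cl K g ∧ c ∈ cl K b})^2 * ((PrW (D.erase s(a, g)) p {K : Finset (Sym2 V) | b ∉ cl K g ∧ c ∉ cl K g ∧ c ∉ cl K b}+PrW (D.erase s(a, g)) p {K : Finset (Sym2 V) | b ∈ cl K g ∧ c ∉ cl K g})*(PrW (D.erase s(a, g)) p {K : Finset (Sym2 V) | b ∉ cl K g ∧ c ∉ cl K g ∧ c ∉ cl K b}+PrW (D.erase s(a, g)) p {K : Finset (Sym2 V) | c ∈ cl K g ∧ b ∉ cl K g}))^3)) :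
    (PrW D p {K : Finset (Sym2 V) | b ∉ cl K a ∧ c ∉ cl K a ∧ c ∉ cl K b}^6 ≤ (PrW D p {K : Finset (Sym2 V) | b ∉ cl K a ∧ c ∉ cl K a ∧ c ∉ cl K b}+PrW D p {K : Finset (Sym2 V) | b ∉ cl K a ∧ c ∉ cl K a ∧ c ∈ cl K b})^2 * ((PrW D p {K : Finset (Sym2 V) | b ∉ cl K a ∧ c ∉ cl K a ∧ c ∉ cl K b}+PrW D p {K : Finset (Sym2 V) | b ∈ cl K a ∧ c ∉ cl K a})*(PrW D p {K : Finset (Sym2 V) | b ∉ cl K a ∧ c ∉ cl K a ∧ c ∉ cl K b}+PrW D p {K : Finset (Sym2 V) | c ∈ cl K a ∧ b ∉ cl K a}))^3) := by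
  have hz0 := hp0 s(a, g)
  have hz1 := hp1 s(a, g)
  obtain ⟨n0, n1, n2, n3, _⟩ := cells_nonneg hp0 hp1 (D.erase s(a, g)) g b c
  have hs := cells_sum_eq_one p (D.erase s(a, g)) g b c
  have key := profile_pendant (PrW (D.erase s(a, g)) p {K : Finset (Sym2 V) | b ∉ cl K g ∧ c ∉ cl K g ∧ c ∉ cl K b}) (PrW (D.erase s(a, g)) p {K : Finset (Sym2 V) | b ∈ cl K g ∧ c ∉ cl K g}) (PrW (D.erase s(a, g)) p {K : Finset (Sym2 V) | c ∈ cl K g ∧ b ∉ cl K g}) (PrW (D.erase s(a, g)) p {K : Finset (Sym2 V) | b ∉ cl K g ∧ c ∉ cl K g ∧ c ∈ cl K b}) (PrW (D.erase s(a, g)) p {K : Finset (Sym2 V) | b ∈ cl K g ∧ c ∈ cl K g})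
    (p s(a, g)) n0 n1 n2 n3 hs hz0 hz1 h
  rw [pendant_cell_zero p D a g b c hag hba hca he hD, pendant_cell_ab p D a g b c hag hba hca he hD, pendant_cell_ac p D a g b c hag hba hca he hD,
    pendant_cell_bc p D a g b c hag hba hca he hD, pendant_split_bc p _ g b c, pendant_split_bc' p _ g b c]
  exact (key.trans_eq (by ring)).trans_eq' (by ring)

/-- An `a`-free piece lies in `P` (cells `(P(b ↮ c), 0, 0, P(b ↔ c), 0)`: equality). [this work] -/
theorem pregion_afree (p : Sym2 V → ℝ) (D : Finset (Sym2 V)) (a b c : V) (hba : b ≠ a) (hca : c ≠ a) (hD : ∀ f ∈ D, a ∉ f) :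
    (PrW D p {K : Finset (Sym2 V) | b ∉ cl K a ∧ c ∉ cl K a ∧ c ∉ cl K b}^6 ≤ (PrW D p {K : Finset (Sym2 V) | b ∉ cl K a ∧ c ∉ cl K a ∧ c ∉ cl K b}+PrW D p {K : Finset (Sym2 V) | b ∉ cl K a ∧ c ∉ cl K a ∧ c ∈ cl K b})^2 * ((PrW D p {K : Finset (Sym2 V) | b ∉ cl K a ∧ c ∉ cl K a ∧ c ∉ cl K b}+PrW D p {K : Finset (Sym2 V) | b ∈ cl K a ∧ c ∉ cl K a})*(PrW D p {K : Finset (Sym2 V) | b ∉ cl K a ∧ c ∉ cl K a ∧ c ∉ cl K b}+PrW D p {K : Finset (Sym2 V) | c ∈ cl K a ∧ b ∉ cl K a}))^3) := by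
  have hs := cells_sum_eq_one p D a b c
  rw [afree_cell_zero p D a b c hba hca hD, afree_cell_ab p D a b c hba hD, afree_cell_ac p D a b c hca hD,
    afree_cell_bc p D a b c hba hca hD] at hs ⊢
  rw [afree_cell_three p D a b c hba hD] at hs
  have h1 : PrW D p {K : Finset (Sym2 V) | c ∉ cl K b} + PrW D p {K : Finset (Sym2 V) | c ∈ cl K b} = 1 := by linear_combination hs
  have e : (PrW D p {K : Finset (Sym2 V) | c ∉ cl K b} + PrW D p {K : Finset (Sym2 V) | c ∈ cl K b})^2
      * ((PrW D p {K : Finset (Sym2 V) | c ∉ cl K b} + 0) * (PrW D p {K : Finset (Sym2 V) | c ∉ cl K b} + 0))^3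
      = (PrW D p {K : Finset (Sym2 V) | c ∉ cl K b})^6 := by
    rw [h1]; ring
  exact le_of_eq e.symm

/-- A single `a–b` edge lies in `P` (cells `(1−x, x, 0, 0, 0)`: `(1−x)⁶ ≤ (1−x)⁵`). [this work] -/
theorem pregion_bEdge {p : Sym2 V → ℝ} (hp0 : ∀ e, 0 ≤ p e) (hp1 : ∀ e, p e ≤ 1) (a b c : V) (hab : a ≠ b) (hac : a ≠ c) (hbc : b ≠ c) :
    (PrW ({s(a, b)} : Finset (Sym2 V)) p {K : Finset (Sym2 V) | b ∉ cl K a ∧ c ∉ cl K a ∧ c ∉ cl K b}^6 ≤ (PrW ({s(a, b)} : Finset (Sym2 V)) p {K : Finset (Sym2 V) | b ∉ cl K a ∧ c ∉ cl K a ∧ c ∉ cl K b}+PrW ({s(a, b)} : Finset (Sym2 V)) p {K : Finset (Sym2 V) | b ∉ cl K a ∧ c ∉ cl K a ∧ c ∈ cl K b})^2 * ((PrW ({s(a, b)} : Finset (Sym2 V)) p {K : Finset (Sym2 V) | b ∉ cl K a ∧ c ∉ cl K a ∧ c ∉ cl K b}+PrW ({s(a, b)} : Finset (Sym2 V)) p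 {K : Finset (Sym2 V) | b ∈ cl K a ∧ c ∉ cl K a})*(PrW ({s(a, b)} : Finset (Sym2 V)) p {K : Finset (Sym2 V) | b ∉ cl K a ∧ c ∉ cl K a ∧ c ∉ cl K b}+PrW ({s(a, b)} : Finset (Sym2 V)) p {K : Finset (Sym2 V) | c ∈ cl K a ∧ b ∉ cl K a}))^3) := by
  rw [bEdge_cell_zero p a b c hab hac hbc, bEdge_cell_ab p a b c hab hac hbc, bEdge_cell_ac p a b c hab hac hbc, bEdge_cell_bc p a b c hab hac hbc]
  have h0 : 0 ≤ 1 - p s(a, b) := sub_nonneg.2 (hp1 _)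
  have h1 : 1 - p s(a, b) ≤ 1 := sub_le_self 1 (hp0 _)
  exact ((pow_le_pow_of_le_one h0 h1 (by norm_num : 5 ≤ 6)).trans_eq (by ring))

/-- A single `a–c` edge lies in `P` (cells `(1−x, 0, x, 0, 0)`). [this work] -/
theorem pregion_cEdge {p : Sym2 V → ℝ} (hp0 : ∀ e, 0 ≤ p e) (hp1 : ∀ e, p e ≤ 1) (a b c : V) (hab : a ≠ b) (hac : a ≠ c) (hbc : b ≠ c) :
    (PrW ({s(a, c)} : Finset (Sym2 V)) p {K : Finset (Sym2 V) | b ∉ cl K a ∧ c ∉ cl K a ∧ c ∉ cl K b}^6 ≤ (PrW ({s(a, c)} : Finset (Sym2 V)) p {K : Finset (Sym2 V) | b ∉ cl K a ∧ c ∉ cl K a ∧ c ∉ cl K b}+PrW ({s(a, c)} : Finset (Sym2 V)) p {K : Finset (Sym2 V) | b ∉ cl K a ∧ c ∉ cl K a ∧ c ∈ cl K b})^2 * ((PrW ({s(a, c)} : Finset (Sym2 V)) p {K : Finset (Sym2 V) | b ∉ cl K a ∧ c ∉ cl K a ∧ c ∉ cl K b}+PrW ({s(a, c)} : Finset (Sym2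 V)) p {K : Finset (Sym2 V) | b ∈ cl K a ∧ c ∉ cl K a})*(PrW ({s(a, c)} : Finset (Sym2 V)) p {K : Finset (Sym2 V) | b ∉ cl K a ∧ c ∉ cl K a ∧ c ∉ cl K b}+PrW ({s(a, c)} : Finset (Sym2 V)) p {K : Finset (Sym2 V) | c ∈ cl K a ∧ b ∉ cl K a}))^3) := by
  rw [cEdge_cell_zero p a b c hab hac hbc, cEdge_cell_ab p a b c hab hac hbc, cEdge_cell_ac p a b c hab hac hbc, cEdge_cell_bc p a b c hab hac hbc]
  have h0 : 0 ≤ 1 - p s(a, c) := sub_nonneg.2 (hp1 _)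
  have h1 : 1 - p s(a, c) ≤ 1 := sub_le_self 1 (hp0 _)
  exact ((pow_le_pow_of_le_one h0 h1 (by norm_num : 5 ≤ 6)).trans_eq (by ring))

set_option maxHeartbeats 0 in
/-- **THEOREM B_P for `PrW` cells** (gen 31 §5, pendant step `profile_pendant` of gen 37).  `0 ≤ p ≤ 1`, `D` loop-free, `a, b, c` distinct,
the forest part `D.filter (b ∉ · ∧ c ∉ ·)` acyclic (bridge form).  Then the cells of `(a; b, c)` on `D` satisfy the PROFILE row
`u0⁶ ≤ (u0+ubc)²((u0+uab)(u0+uac))³`.  Same induction as `conjF_forest`. [this work] -/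
theorem profile_forest {p : Sym2 V → ℝ} (hp0 : ∀ e, 0 ≤ p e) (hp1 : ∀ e, p e ≤ 1) (b c : V) (hbc : b ≠ c) :
    ∀ (n : ℕ) (D : Finset (Sym2 V)) (a : V), D.card = n → a ≠ b → a ≠ c → (∀ f ∈ D, ¬ f.IsDiag) →
      (∀ u v : V, s(u, v) ∈ D → b ∉ s(u, v) → c ∉ s(u, v) →
        ¬ (openGraph (↑((D.filter fun f => b ∉ f ∧ c ∉ f).erase s(u, v)) : Set (Sym2 V))).Reachable u v) →
      (PrW D p {K : Finset (Sym2 V) | b ∉ cl K a ∧ c ∉ cl K a ∧ c ∉ cl K b}^6 ≤ (PrW D p {K : Finset (Sym2 V) | b ∉ cl K a ∧ c ∉ cl K a ∧ c ∉ cl K b}+PrW D p {K : Finset (Sym2 V) | b ∉ cl K a ∧ c ∉ cl K a ∧ c ∈ cl K b})^2 * ((PrW D p {K : Finset (Sym2 V) | b ∉ cl K a ∧ c ∉ cl K a ∧ c ∉ cl K b}+PrW D p {K : Finset (Sym2 V) | b ∈ cl K a ∧ c ∉ cl K a})*(PrW D p {K : Finset (Sym2 V) | b ∉ cl K a ∧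 c ∉ cl K a ∧ c ∉ cl K b}+PrW D p {K : Finset (Sym2 V) | c ∈ cl K a ∧ b ∉ cl K a}))^3) := by
  intro n
  induction n using Nat.strong_induction_on with
  | _ n ih =>
  intro D a hcard hab hac hloop hF
  -- (1) peel an `a–b` edge
  by_cases h1 : s(a, b) ∈ D
  · have hD : ({s(a, b)} : Finset (Sym2 V)) ∪ D.erase s(a, b) = D := by
      rw [← Finset.insert_eq, Finset.insert_erase h1]
    have hlt : (D.erase s(a, b)).card < n := by rw [← hcard]; exact Finset.card_erase_lt_of_mem h1
    have hrest := ih _ hlt (D.erase s(a, b)) a rfl hab hac (noLoop_mono (Finset.erase_subset _ _) hloop)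
      (forest_mono (Finset.erase_subset _ _) b c hF)
    rw [← hD]
    refine pregion_glue hp0 hp1 _ _ (Finset.disjoint_singleton_left.2 (Finset.notMem_erase _ _)) a b c ?_
      (pregion_bEdge hp0 hp1 a b c hab hac hbc) hrest
    rintro v ⟨f, hf, hvf⟩ _
    rw [Finset.mem_singleton] at hf
    rw [hf, Sym2.mem_iff] at hvf
    rcases hvf with h | h
    · exact Or.inl h
    · exact Or.inr (Or.inl h)
  -- (2) peel an `a–c` edge
  by_cases h2 : s(a, c) ∈ D
  · have hD : ({s(a, c)} : Finset (Sym2 V)) ∪ D.erase s(a, c) = D := by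
      rw [← Finset.insert_eq, Finset.insert_erase h2]
    have hlt : (D.erase s(a, c)).card < n := by rw [← hcard]; exact Finset.card_erase_lt_of_mem h2
    have hrest := ih _ hlt (D.erase s(a, c)) a rfl hab hac (noLoop_mono (Finset.erase_subset _ _) hloop)
      (forest_mono (Finset.erase_subset _ _) b c hF)
    rw [← hD]
    refine pregion_glue hp0 hp1 _ _ (Finset.disjoint_singleton_left.2 (Finset.notMem_erase _ _)) a b c ?_
      (pregion_cEdge hp0 hp1 a b c hab hac hbc) hrest
    rintro v ⟨f, hf, hvf⟩ _
    rw [Finset.mem_singleton] at hf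
    rw [hf, Sym2.mem_iff] at hvf
    rcases hvf with h | h
    · exact Or.inl h
    · exact Or.inr (Or.inr h)
  -- (3) `a` isolated
  by_cases h3 : ∃ f ∈ D, a ∈ f
  swap
  · exact pregion_afree p D a b c (Ne.symm hab) (Ne.symm hac) fun f hf haf => h3 ⟨f, hf, haf⟩
  -- (4) a non-terminal neighbour `g`
  obtain ⟨f, hf, haf⟩ := h3
  set g : V := Sym2.Mem.other haf with hg
  have hfg : f = s(a, g) := (Sym2.other_spec haf).symm
  have hga : g ≠ a := Sym2.other_ne (hloop f hf) haf
  have he : s(a, g) ∈ D := hfg ▸ hf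
  have hgb : g ≠ b := fun h => h1 (h ▸ he)
  have hgc : g ≠ c := fun h => h2 (h ▸ he)
  by_cases h4 : (D.filter fun f => ¬ ∃ v ∈ (cl (D.filter fun f => a ∉ f ∧ b ∉ f ∧ c ∉ f) g), v ∈ f) = ∅
  · -- (4B) the rest is empty: `a` is pendant on `g`
    have hG : (D.filter fun f => ∃ v ∈ (cl (D.filter fun f => a ∉ f ∧ b ∉ f ∧ c ∉ f) g), v ∈ f) = D := by
      have hu := apexSplit_union D a b c g
      rwa [h4, Finset.union_empty] at hu
    have honly : ∀ f ∈ D, a ∈ f → f = s(a, g) := by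
      have hb : b ∉ s(a, g) := by rw [Sym2.mem_iff, not_or]; exact ⟨hab.symm, hgb.symm⟩
      have hc : c ∉ s(a, g) := by rw [Sym2.mem_iff, not_or]; exact ⟨hac.symm, hgc.symm⟩
      have h := apexSplit_apex_edge D a b c g hab hac hga hgb hgc (hF a g he hb hc)
      rw [hG] at h
      exact h
    have hlt : (D.erase s(a, g)).card < n := by rw [← hcard]; exact Finset.card_erase_lt_of_mem he
    have hrest := ih _ hlt (D.erase s(a, g)) g rfl hgb hgc (noLoop_mono (Finset.erase_subset _ _) hloop)
      (forest_mono (Finset.erase_subset _ _) b c hF)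
    exact pregion_pendant hp0 hp1 D a g b c hga.symm (Ne.symm hab) (Ne.symm hac) he honly hrest
  · -- (4A) proper gluing of the piece through `g` and the rest
    have hHne : ((D.filter fun f => ¬ ∃ v ∈ (cl (D.filter fun f => a ∉ f ∧ b ∉ f ∧ c ∉ f) g), v ∈ f)).Nonempty := Finset.nonempty_iff_ne_empty.2 h4
    have hG1ne : ((D.filter fun f => ∃ v ∈ (cl (D.filter fun f => a ∉ f ∧ b ∉ f ∧ c ∉ f) g), v ∈ f)).Nonempty := ⟨_, apexSplit_mem D a b c g he⟩
    have hcardU := Finset.card_union_of_disjoint (apexSplit_disjoint D a b c g)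
    rw [apexSplit_union D a b c g, hcard] at hcardU
    have hpos1 := hG1ne.card_pos
    have hpos2 := hHne.card_pos
    have hsub1 : (D.filter fun f => ∃ v ∈ (cl (D.filter fun f => a ∉ f ∧ b ∉ f ∧ c ∉ f) g), v ∈ f) ⊆ D := Finset.filter_subset _ D
    have hsub2 : (D.filter fun f => ¬ ∃ v ∈ (cl (D.filter fun f => a ∉ f ∧ b ∉ f ∧ c ∉ f) g), v ∈ f) ⊆ D := Finset.filter_subset _ D
    have r1 := ih _ (by omega) (D.filter fun f => ∃ v ∈ (cl (D.filter fun f => a ∉ f ∧ b ∉ f ∧ c ∉ f) g), v ∈ f) a rfl hab hac (noLoop_mono hsub1 hloop) (forest_mono hsub1 b c hF)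
    have r2 := ih _ (by omega) (D.filter fun f => ¬ ∃ v ∈ (cl (D.filter fun f => a ∉ f ∧ b ∉ f ∧ c ∉ f) g), v ∈ f) a rfl hab hac (noLoop_mono hsub2 hloop) (forest_mono hsub2 b c hF)
    rw [← apexSplit_union D a b c g]
    exact pregion_glue hp0 hp1 _ _ (apexSplit_disjoint D a b c g) a b c (apexSplit_glued D a b c g hga hgb hgc) r1 r2

end Cells

set_option maxHeartbeats 0 in
/-- **THEOREM B_P for bond percolation (cell form).**  `μ = prodBernoulli w`, `a, b, c` distinct, the positive-weight non-loop pairs avoiding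
`b, c` form an acyclic graph.  Then `μ(a|b|c)⁶ ≤ (μ(a|b|c)+μ(a|bc))²·((μ(a|b|c)+μ(ab|c))·(μ(a|b|c)+μ(ac|b)))³`. [this work] -/
theorem profile_forest_prodBernoulli (w : Sym2 V → unitInterval) (a b c : V) (hab : a ≠ b) (hac : a ≠ c) (hbc : b ≠ c)
    (hforest : (openGraph (↑((Finset.univ.filter fun e : Sym2 V => ¬ e.IsDiag ∧ 0 < (w e : ℝ)).filter fun f => b ∉ f ∧ c ∉ f) : Set (Sym2 V))).IsAcyclic) :
    (prodBernoulli w).real ((openConn a b)ᶜ ∩ (openConn a c)ᶜ ∩ (openConn b c)ᶜ)^6 ≤ ((prodBernoulli w).real ((openConn a b)ᶜ ∩ (openConn a c)ᶜ ∩ (openConn b c)ᶜ)+(prodBernoulli w).real ((openConn a b)ᶜ ∩ (openConn a c)ᶜ ∩ openConn b c))^2 * (((prodBernoulli w).real ((openConn a b)ᶜ ∩ (openConn a c)ᶜ ∩ (openConn b c)ᶜ)+(prodBernoulli w).real (openConn a b ∩ (openConn a c)ᶜ))*((prodBernoulli w).real ((openConn a b)ᶜ ∩ (openConn a c)ᶜ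 ∩ (openConn b c)ᶜ)+(prodBernoulli w).real (openConn a c ∩ (openConn a b)ᶜ)))^3 := by
  classical
  have hcl : ∀ (S : Finset (Sym2 V)) (u v : V), (↑S : Set (Sym2 V)) ∈ openConn u v ↔ v ∈ cl S u :=
    fun S u v => by rw [mem_cl]; rfl
  have c_zero : (prodBernoulli w).real ((openConn a b)ᶜ ∩ (openConn a c)ᶜ ∩ (openConn b c)ᶜ)
      = PrW (Finset.univ.filter fun e : Sym2 V => ¬ e.IsDiag ∧ 0 < (w e : ℝ)) (fun e => (w e : ℝ)) {K : Finset (Sym2 V) | b ∉ cl K a ∧ c ∉ cl K a ∧ c ∉ cl K b} := by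
    rw [prodBernoulli_real_eq_PrW_univ w (X := {K : Finset (Sym2 V) | b ∉ cl K a ∧ c ∉ cl K a ∧ c ∉ cl K b}) fun S => by
      simp only [Set.mem_setOf_eq, Set.mem_inter_iff, Set.mem_compl_iff, hcl, and_assoc]]
    exact PrW_univ_eq_support w {K : Finset (Sym2 V) | b ∉ cl K a ∧ c ∉ cl K a ∧ c ∉ cl K b} fun S T hT => by
      simp only [Set.mem_setOf_eq, cl_union_diag S T hT]
  have c_ab : (prodBernoulli w).real (openConn a b ∩ (openConn a c)ᶜ)
      = PrW (Finset.univ.filter fun e : Sym2 V => ¬ e.IsDiag ∧ 0 < (w e : ℝ)) (fun e => (w e : ℝ)) {K : Finset (Sym2 V) | b ∈ cl K a ∧ c ∉ cl K a} := by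
    rw [prodBernoulli_real_eq_PrW_univ w (X := {K : Finset (Sym2 V) | b ∈ cl K a ∧ c ∉ cl K a}) fun S => by
      simp only [Set.mem_setOf_eq, Set.mem_inter_iff, Set.mem_compl_iff, hcl]]
    exact PrW_univ_eq_support w {K : Finset (Sym2 V) | b ∈ cl K a ∧ c ∉ cl K a} fun S T hT => by
      simp only [Set.mem_setOf_eq, cl_union_diag S T hT]
  have c_ac : (prodBernoulli w).real (openConn a c ∩ (openConn a b)ᶜ)
      = PrW (Finset.univ.filter fun e : Sym2 V => ¬ e.IsDiag ∧ 0 < (w e : ℝ)) (fun e => (w e : ℝ)) {K : Finset (Sym2 V) | c ∈ cl K a ∧ b ∉ cl K a} := by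
    rw [prodBernoulli_real_eq_PrW_univ w (X := {K : Finset (Sym2 V) | c ∈ cl K a ∧ b ∉ cl K a}) fun S => by
      simp only [Set.mem_setOf_eq, Set.mem_inter_iff, Set.mem_compl_iff, hcl]]
    exact PrW_univ_eq_support w {K : Finset (Sym2 V) | c ∈ cl K a ∧ b ∉ cl K a} fun S T hT => by
      simp only [Set.mem_setOf_eq, cl_union_diag S T hT]
  have c_bc : (prodBernoulli w).real ((openConn a b)ᶜ ∩ (openConn a c)ᶜ ∩ openConn b c)
      = PrW (Finset.univ.filter fun e : Sym2 V => ¬ e.IsDiag ∧ 0 < (w e : ℝ)) (fun e => (w e : ℝ)) {K : Finset (Sym2 V) | b ∉ cl K a ∧ c ∉ cl K a ∧ c ∈ cl K b} := by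
    rw [prodBernoulli_real_eq_PrW_univ w (X := {K : Finset (Sym2 V) | b ∉ cl K a ∧ c ∉ cl K a ∧ c ∈ cl K b}) fun S => by
      simp only [Set.mem_setOf_eq, Set.mem_inter_iff, Set.mem_compl_iff, hcl, and_assoc]]
    exact PrW_univ_eq_support w {K : Finset (Sym2 V) | b ∉ cl K a ∧ c ∉ cl K a ∧ c ∈ cl K b} fun S T hT => by
      simp only [Set.mem_setOf_eq, cl_union_diag S T hT]
  rw [c_zero, c_ab, c_ac, c_bc]
  have hp0 : ∀ e, 0 ≤ (fun e => (w e : ℝ)) e := fun e => (w e).2.1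
  have hp1 : ∀ e, (fun e => (w e : ℝ)) e ≤ 1 := fun e => (w e).2.2
  refine profile_forest hp0 hp1 b c hbc _ (Finset.univ.filter fun e : Sym2 V => ¬ e.IsDiag ∧ 0 < (w e : ℝ)) a rfl hab hac (fun f hf => (Finset.mem_filter.1 hf).2.1) ?_
  -- acyclicity in bridge form
  intro u v huv hbu hcu hreach
  have hne : u ≠ v := fun h => (Finset.mem_filter.1 huv).2.1 (Sym2.mk_isDiag_iff.2 h)
  have hadj : (openGraph (↑((Finset.univ.filter fun e : Sym2 V => ¬ e.IsDiag ∧ 0 < (w e : ℝ)).filter fun f => b ∉ f ∧ c ∉ f) : Set (Sym2 V))).Adj u v :=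
    adj_iff.2 ⟨Finset.mem_filter.2 ⟨huv, hbu, hcu⟩, hne⟩
  have hbr := SimpleGraph.isBridge_iff.1 (SimpleGraph.isAcyclic_iff_forall_adj_isBridge.1 hforest hadj)
  refine hbr (hreach.mono fun x y hxy => ?_)
  rw [SimpleGraph.deleteEdges_adj]
  obtain ⟨h1, h2⟩ := adj_iff.1 hxy
  exact ⟨adj_iff.2 ⟨(Finset.mem_erase.1 h1).2, h2⟩, by simpa using (Finset.mem_erase.1 h1).1⟩

set_option maxHeartbeats 0 in
/-- **THEOREM B_P (isolation form).**  On the same class: `μ(a|b|c)⁶ ≤ μ(a∤bc)² · (μ(c∤ab)·μ(b∤ac))³`, where `a ∤ bc` is the event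
`a ↮ b ∧ a ↮ c` etc. — a reverse-Harris bound for the two decreasing events `b ∤ ac`, `c ∤ ab`, whose intersection is `a|b|c`. [this work] -/
theorem profile_forest_iso (w : Sym2 V → unitInterval) (a b c : V) (hab : a ≠ b) (hac : a ≠ c) (hbc : b ≠ c)
    (hforest : (openGraph (↑((Finset.univ.filter fun e : Sym2 V => ¬ e.IsDiag ∧ 0 < (w e : ℝ)).filter fun f => b ∉ f ∧ c ∉ f) : Set (Sym2 V))).IsAcyclic) :
    (prodBernoulli w).real ((openConn a b)ᶜ ∩ (openConn a c)ᶜ ∩ (openConn b c)ᶜ) ^ 6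
      ≤ (prodBernoulli w).real ((openConn a b)ᶜ ∩ (openConn a c)ᶜ) ^ 2
        * ((prodBernoulli w).real ((openConn a c)ᶜ ∩ (openConn b c)ᶜ) * (prodBernoulli w).real ((openConn a b)ᶜ ∩ (openConn b c)ᶜ)) ^ 3 := by
  classical
  have hmain := profile_forest_prodBernoulli w a b c hab hac hbc hforest
  have hcl : ∀ (S : Finset (Sym2 V)) (u v : V), (↑S : Set (Sym2 V)) ∈ openConn u v ↔ v ∈ cl S u :=
    fun S u v => by rw [mem_cl]; rfl
  have c_zero : (prodBernoulli w).real ((openConn a b)ᶜ ∩ (openConn a c)ᶜ ∩ (openConn b c)ᶜ)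
      = PrW (Finset.univ.filter fun e : Sym2 V => ¬ e.IsDiag ∧ 0 < (w e : ℝ)) (fun e => (w e : ℝ)) {K : Finset (Sym2 V) | b ∉ cl K a ∧ c ∉ cl K a ∧ c ∉ cl K b} := by
    rw [prodBernoulli_real_eq_PrW_univ w (X := {K : Finset (Sym2 V) | b ∉ cl K a ∧ c ∉ cl K a ∧ c ∉ cl K b}) fun S => by
      simp only [Set.mem_setOf_eq, Set.mem_inter_iff, Set.mem_compl_iff, hcl, and_assoc]]
    exact PrW_univ_eq_support w {K : Finset (Sym2 V) | b ∉ cl K a ∧ c ∉ cl K a ∧ c ∉ cl K b} fun S T hT => by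
      simp only [Set.mem_setOf_eq, cl_union_diag S T hT]
  have c_ab : (prodBernoulli w).real (openConn a b ∩ (openConn a c)ᶜ)
      = PrW (Finset.univ.filter fun e : Sym2 V => ¬ e.IsDiag ∧ 0 < (w e : ℝ)) (fun e => (w e : ℝ)) {K : Finset (Sym2 V) | b ∈ cl K a ∧ c ∉ cl K a} := by
    rw [prodBernoulli_real_eq_PrW_univ w (X := {K : Finset (Sym2 V) | b ∈ cl K a ∧ c ∉ cl K a}) fun S => by
      simp only [Set.mem_setOf_eq, Set.mem_inter_iff, Set.mem_compl_iff, hcl]]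
    exact PrW_univ_eq_support w {K : Finset (Sym2 V) | b ∈ cl K a ∧ c ∉ cl K a} fun S T hT => by
      simp only [Set.mem_setOf_eq, cl_union_diag S T hT]
  have c_ac : (prodBernoulli w).real (openConn a c ∩ (openConn a b)ᶜ)
      = PrW (Finset.univ.filter fun e : Sym2 V => ¬ e.IsDiag ∧ 0 < (w e : ℝ)) (fun e => (w e : ℝ)) {K : Finset (Sym2 V) | c ∈ cl K a ∧ b ∉ cl K a} := by
    rw [prodBernoulli_real_eq_PrW_univ w (X := {K : Finset (Sym2 V) | c ∈ cl K a ∧ b ∉ cl K a}) fun S => by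
      simp only [Set.mem_setOf_eq, Set.mem_inter_iff, Set.mem_compl_iff, hcl]]
    exact PrW_univ_eq_support w {K : Finset (Sym2 V) | c ∈ cl K a ∧ b ∉ cl K a} fun S T hT => by
      simp only [Set.mem_setOf_eq, cl_union_diag S T hT]
  have c_bc : (prodBernoulli w).real ((openConn a b)ᶜ ∩ (openConn a c)ᶜ ∩ openConn b c)
      = PrW (Finset.univ.filter fun e : Sym2 V => ¬ e.IsDiag ∧ 0 < (w e : ℝ)) (fun e => (w e : ℝ)) {K : Finset (Sym2 V) | b ∉ cl K a ∧ c ∉ cl K a ∧ c ∈ cl K b} := by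
    rw [prodBernoulli_real_eq_PrW_univ w (X := {K : Finset (Sym2 V) | b ∉ cl K a ∧ c ∉ cl K a ∧ c ∈ cl K b}) fun S => by
      simp only [Set.mem_setOf_eq, Set.mem_inter_iff, Set.mem_compl_iff, hcl, and_assoc]]
    exact PrW_univ_eq_support w {K : Finset (Sym2 V) | b ∉ cl K a ∧ c ∉ cl K a ∧ c ∈ cl K b} fun S T hT => by
      simp only [Set.mem_setOf_eq, cl_union_diag S T hT]
  have c_isoA : (prodBernoulli w).real ((openConn a b)ᶜ ∩ (openConn a c)ᶜ)
      = PrW (Finset.univ.filter fun e : Sym2 V => ¬ e.IsDiag ∧ 0 < (w e : ℝ)) (fun e => (w e : ℝ)) {K : Finset (Sym2 V) | b ∉ cl K a ∧ c ∉ cl K a} := by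
    rw [prodBernoulli_real_eq_PrW_univ w (X := {K : Finset (Sym2 V) | b ∉ cl K a ∧ c ∉ cl K a}) fun S => by
      simp only [Set.mem_setOf_eq, Set.mem_inter_iff, Set.mem_compl_iff, hcl]]
    exact PrW_univ_eq_support w {K : Finset (Sym2 V) | b ∉ cl K a ∧ c ∉ cl K a} fun S T hT => by
      simp only [Set.mem_setOf_eq, cl_union_diag S T hT]
  have c_isoB : (prodBernoulli w).real ((openConn a b)ᶜ ∩ (openConn b c)ᶜ)
      = PrW (Finset.univ.filter fun e : Sym2 V => ¬ e.IsDiag ∧ 0 < (w e : ℝ)) (fun e => (w e : ℝ)) {K : Finset (Sym2 V) | b ∉ cl K a ∧ c ∉ cl K b} := by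
    rw [prodBernoulli_real_eq_PrW_univ w (X := {K : Finset (Sym2 V) | b ∉ cl K a ∧ c ∉ cl K b}) fun S => by
      simp only [Set.mem_setOf_eq, Set.mem_inter_iff, Set.mem_compl_iff, hcl]]
    exact PrW_univ_eq_support w {K : Finset (Sym2 V) | b ∉ cl K a ∧ c ∉ cl K b} fun S T hT => by
      simp only [Set.mem_setOf_eq, cl_union_diag S T hT]
  have c_isoC : (prodBernoulli w).real ((openConn a c)ᶜ ∩ (openConn b c)ᶜ)
      = PrW (Finset.univ.filter fun e : Sym2 V => ¬ e.IsDiag ∧ 0 < (w e : ℝ)) (fun e => (w e : ℝ)) {K : Finset (Sym2 V) | c ∉ cl K a ∧ c ∉ cl K b} := by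
    rw [prodBernoulli_real_eq_PrW_univ w (X := {K : Finset (Sym2 V) | c ∉ cl K a ∧ c ∉ cl K b}) fun S => by
      simp only [Set.mem_setOf_eq, Set.mem_inter_iff, Set.mem_compl_iff, hcl]]
    exact PrW_univ_eq_support w {K : Finset (Sym2 V) | c ∉ cl K a ∧ c ∉ cl K b} fun S T hT => by
      simp only [Set.mem_setOf_eq, cl_union_diag S T hT]
  rw [c_isoA, c_isoB, c_isoC, split_isoA, split_isoB, split_isoC, ← c_zero, ← c_ab, ← c_ac, ← c_bc]
  exact hmain

/-- **THEOREM B_P (the `3/2`-power form of gen 31).**  `μ(a|b|c)³ ≤ μ(a∤bc) · (μ(c∤ab)·μ(b∤ac))^(3/2)`. [this work] -/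
theorem profile_forest_rpow (w : Sym2 V → unitInterval) (a b c : V) (hab : a ≠ b) (hac : a ≠ c) (hbc : b ≠ c)
    (hforest : (openGraph (↑((Finset.univ.filter fun e : Sym2 V => ¬ e.IsDiag ∧ 0 < (w e : ℝ)).filter fun f => b ∉ f ∧ c ∉ f) : Set (Sym2 V))).IsAcyclic) :
    (prodBernoulli w).real ((openConn a b)ᶜ ∩ (openConn a c)ᶜ ∩ (openConn b c)ᶜ) ^ 3
      ≤ (prodBernoulli w).real ((openConn a b)ᶜ ∩ (openConn a c)ᶜ)
        * ((prodBernoulli w).real ((openConn a c)ᶜ ∩ (openConn b c)ᶜ) * (prodBernoulli w).real ((openConn a b)ᶜ ∩ (openConn b c)ᶜ)) ^ (3 / 2 : ℝ) := by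
  have h6 := profile_forest_iso w a b c hab hac hbc hforest
  have hu0 : 0 ≤ (prodBernoulli w).real ((openConn a b)ᶜ ∩ (openConn a c)ᶜ ∩ (openConn b c)ᶜ) := measureReal_nonneg
  have hA0 : 0 ≤ (prodBernoulli w).real ((openConn a b)ᶜ ∩ (openConn a c)ᶜ) := measureReal_nonneg
  have hB0 : 0 ≤ (prodBernoulli w).real ((openConn a c)ᶜ ∩ (openConn b c)ᶜ) * (prodBernoulli w).real ((openConn a b)ᶜ ∩ (openConn b c)ᶜ) :=
    mul_nonneg measureReal_nonneg measureReal_nonneg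
  have hsq : (((prodBernoulli w).real ((openConn a c)ᶜ ∩ (openConn b c)ᶜ) * (prodBernoulli w).real ((openConn a b)ᶜ ∩ (openConn b c)ᶜ)) ^ (3 / 2 : ℝ)) ^ 2
      = ((prodBernoulli w).real ((openConn a c)ᶜ ∩ (openConn b c)ᶜ) * (prodBernoulli w).real ((openConn a b)ᶜ ∩ (openConn b c)ᶜ)) ^ 3 := by
    rw [← Real.rpow_natCast (((prodBernoulli w).real ((openConn a c)ᶜ ∩ (openConn b c)ᶜ) * (prodBernoulli w).real ((openConn a b)ᶜ ∩ (openConn b c)ᶜ)) ^ (3 / 2 : ℝ)) 2,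
      ← Real.rpow_mul hB0]
    norm_num
  have hR0 : 0 ≤ (prodBernoulli w).real ((openConn a b)ᶜ ∩ (openConn a c)ᶜ)
      * ((prodBernoulli w).real ((openConn a c)ᶜ ∩ (openConn b c)ᶜ) * (prodBernoulli w).real ((openConn a b)ᶜ ∩ (openConn b c)ᶜ)) ^ (3 / 2 : ℝ) := mul_nonneg hA0 (Real.rpow_nonneg hB0 _)
  have key : ((prodBernoulli w).real ((openConn a b)ᶜ ∩ (openConn a c)ᶜ ∩ (openConn b c)ᶜ) ^ 3) ^ 2
      ≤ ((prodBernoulli w).real ((openConn a b)ᶜ ∩ (openConn a c)ᶜ)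
        * ((prodBernoulli w).real ((openConn a c)ᶜ ∩ (openConn b c)ᶜ) * (prodBernoulli w).real ((openConn a b)ᶜ ∩ (openConn b c)ᶜ)) ^ (3 / 2 : ℝ)) ^ 2 := by
    calc ((prodBernoulli w).real ((openConn a b)ᶜ ∩ (openConn a c)ᶜ ∩ (openConn b c)ᶜ) ^ 3) ^ 2
        = (prodBernoulli w).real ((openConn a b)ᶜ ∩ (openConn a c)ᶜ ∩ (openConn b c)ᶜ) ^ 6 := by ring
      _ ≤ (prodBernoulli w).real ((openConn a b)ᶜ ∩ (openConn a c)ᶜ) ^ 2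
        * ((prodBernoulli w).real ((openConn a c)ᶜ ∩ (openConn b c)ᶜ) * (prodBernoulli w).real ((openConn a b)ᶜ ∩ (openConn b c)ᶜ)) ^ 3 := h6
      _ = (prodBernoulli w).real ((openConn a b)ᶜ ∩ (openConn a c)ᶜ) ^ 2
        * (((prodBernoulli w).real ((openConn a c)ᶜ ∩ (openConn b c)ᶜ) * (prodBernoulli w).real ((openConn a b)ᶜ ∩ (openConn b c)ᶜ)) ^ (3 / 2 : ℝ)) ^ 2 := by rw [hsq]
      _ = ((prodBernoulli w).real ((openConn a b)ᶜ ∩ (openConn a c)ᶜ)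
        * ((prodBernoulli w).real ((openConn a c)ᶜ ∩ (openConn b c)ᶜ) * (prodBernoulli w).real ((openConn a b)ᶜ ∩ (openConn b c)ᶜ)) ^ (3 / 2 : ℝ)) ^ 2 := by ring
  exact (pow_le_pow_iff_left₀ (pow_nonneg hu0 3) hR0 two_ne_zero).1 key

end APL

end Summit.CriticalPhenomena.PercolationContinuityZ3.Theorems
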